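import Literature.Computability.Complexity.CyclicListBricks
import HarnessLib

/-!
# Cyclic list bricks, II: powering in `ℤ_n[X]/(X^r - 1)` by repeated squaring, in `FP`

Continuation of `CyclicListBricks.lean` (`Brick.mulG`: the product of two coefficient lists modulo
`(X^r - 1, n)`, with its absolute output bound `Brick.length_mulG_le`). Here the counted loop that runs
the LSB-first square-and-multiply scheme `CycList.powAux` of `CyclicListArith.lean` — the inner loop of
the AKS congruence test [AKS04, §5, proof of Thm 5.1: "`O(log n)` multiplications of degree-`< r`
polynomials with coefficients of size `O(log n)`"]:

* `Brick.powBody` — one round `(e, acc, base) ↦ (e / 2, acc · base^(e mod 2), base²)` on the state of a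
  `Brick.loopStep` record `⟨x, ⟨cnt, ⟨e, ⟨acc, base⟩⟩⟩⟩`, its value on genuine states (`powBody_record`),
  its growth `≤ |state| + powGrowth (|x|)` on every input (`length_powBody_le`), `powBody ∈ FP`;
* `Brick.loopModel_powBody` — `k` rounds compute `CycList.powAux n k e acc base`;
* `Brick.oneOfG ⟨x, B⟩` — the code of `CycList.one r` for a list `B` of `r ≥ 1` entries;
* **`Brick.powG ⟨x, B⟩ = pcode (CycList.powAux n |ν| n (one r) B)`** for `x = ⟨ν, u⟩`, `n = ⟦ν⟧ ≥ 2`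
  (`powG_apply`): `|ν|` rounds from `(n, 1, B)`, i.e. `B ^ n` when `ν = encodeNat n`; `powG ∈ FP`.

## References

* [AKS04] M. Agrawal, N. Kayal, N. Saxena, *PRIMES is in P*, Ann. of Math. 160 (2004) 781–793, §5.
* D. E. Knuth, *The Art of Computer Programming*, Vol. 2, 3rd ed., 1998, §4.6.3 (Algorithm A).
* S. Arora, B. Barak, *Computational Complexity: A Modern Approach*, CUP 2009, §1.3, §1.4.1.
-/

namespace Literature.Computability.Complexity

open _root_.Computability Polynomial

namespace Brick

/-! ### One round of square-and-multiply -/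

/-- The new accumulator: `acc` if `⟦e⟧` is even, `mulG ⟨x, ⟨acc, base⟩⟩` if odd (fields of
`z = ⟨x, ⟨cnt, ⟨e, ⟨acc, base⟩⟩⟩⟩`). [cite: KnuthTAOCP2, §4.6.3 (Algorithm A, step A3)] -/
noncomputable def powAccF : List Bool → List Bool :=
  iteFn (parityFn ∘ nthF 2) (nthF 3) (mulG ∘ fanoutFn fstF (fanoutFn (nthF 3) (sndPow 3)))

/-- **One round** `powBody z = ⟨bin (⟦e⟧ / 2), ⟨powAccF z, mulG ⟨x, ⟨base, base⟩⟩⟩⟩`.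
[cite: KnuthTAOCP2, §4.6.3 (Algorithm A)] -/
noncomputable def powBody : List Bool → List Bool :=
  fanoutFn (divFn ∘ fanoutFn (nthF 2) (fun _ => encodeNat 2))
    (fanoutFn powAccF (mulG ∘ fanoutFn fstF (fanoutFn (sndPow 3) (sndPow 3))))

/-- `powAccF ∈ FP`. [folklore] -/
theorem powAccF_mem_FP : powAccF ∈ FP :=
  iteFn_mem_FP (comp_mem_FP parityFn_mem_FP (nthF_mem_FP 2)) (nthF_mem_FP 3)
    (comp_mem_FP mulG_mem_FP (fanoutFn_mem_FP fstF_mem_FP (fanoutFn_mem_FP (nthF_mem_FP 3) (sndPow_mem_FP 3))))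

/-- `powBody ∈ FP`. [folklore] -/
theorem powBody_mem_FP : powBody ∈ FP :=
  fanoutFn_mem_FP (comp_mem_FP divFn_mem_FP (fanoutFn_mem_FP (nthF_mem_FP 2) (const_mem_FP _)))
    (fanoutFn_mem_FP powAccF_mem_FP (comp_mem_FP mulG_mem_FP (fanoutFn_mem_FP fstF_mem_FP (fanoutFn_mem_FP (sndPow_mem_FP 3) (sndPow_mem_FP 3)))))

/-- `powAccF` on an arbitrary record. [folklore] -/
theorem powAccF_apply (x c e acc base : List Bool) :
    powAccF (boolPair x (boolPair c (boolPair e (boolPair acc base)))) =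
      if Even (bitsToNat e) then acc else mulG (boolPair x (boolPair acc base)) := by
  by_cases h : Even (bitsToNat e)
  · rw [powAccF, iteFn_apply_true (by simp [parityFn, h]), if_pos h]; simp
  · rw [powAccF, iteFn_apply_false (by simp [parityFn, h]), if_neg h]; simp

/-- `powBody` on an arbitrary record. [folklore] -/
theorem powBody_apply (x c e acc base : List Bool) :
    powBody (boolPair x (boolPair c (boolPair e (boolPair acc base)))) =
      boolPair (encodeNat (bitsToNat e / 2))
        (boolPair (if Even (bitsToNat e) then acc else mulG (boolPair x (boolPair acc base)))
          (mulG (boolPair x (boolPair base base)))) := by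
  rw [powBody, fanoutFn_apply, fanoutFn_apply, powAccF_apply]
  simp

/-- **`powBody` on a genuine state** `⟨e, ⟨pcode acc, pcode base⟩⟩` (any exponent string `e`, lists of the
same length `≤ |x|`, modulus `n = ⟦fstF x⟧ ≥ 2`): the next state of `CycList.powAux`.
[cite: KnuthTAOCP2, §4.6.3 (Algorithm A)] -/
theorem powBody_record {x : List Bool} (hx : 2 ≤ bitsToNat (fstF x)) (c e : List Bool) {acc base : List ℕ}
    (hab : acc.length = base.length) (hb : base.length ≤ x.length) :
    powBody (boolPair x (boolPair c (boolPair e (boolPair (pcode acc) (pcode base))))) =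
      boolPair (encodeNat (bitsToNat e / 2))
        (boolPair (pcode (if bitsToNat e % 2 = 1 then CycList.mul (bitsToNat (fstF x)) acc base else acc))
          (pcode (CycList.mul (bitsToNat (fstF x)) base base))) := by
  rw [powBody_apply, mulG_apply hx rfl hb]
  by_cases he : bitsToNat e % 2 = 1
  · rw [if_neg (by rw [Nat.even_iff]; omega), if_pos he, mulG_apply hx hab hb]
  · rw [if_pos (by rw [Nat.even_iff]; omega), if_neg he]

/-- The growth allowance of one round: three product bounds and the record overhead. [folklore] -/
noncomputable def powGrowth : Polynomial ℕ := 3 * mulBound + 4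

/-- **Growth of one round**: `|powBody z| ≤ |sndPow 1 z| + powGrowth (|fstF z|)` on every input
(the exponent shrinks, the accumulator is kept or replaced by a product, the base by a product).
[folklore] -/
theorem length_powBody_le (z : List Bool) : (powBody z).length ≤ (sndPow 1 z).length + powGrowth.eval (fstF z).length := by
  have h1 := length_nthF_succ_add_sndPow_succ_le 1 z
  have h2 := length_nthF_succ_add_sndPow_succ_le 2 z
  have hm1 := length_mulG_le (boolPair (fstF z) (boolPair (nthF 3 z) (sndPow 3 z)))
  have hm2 := length_mulG_le (boolPair (fstF z) (boolPair (sndPow 3 z) (sndPow 3 z)))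
  rw [fstF_boolPair] at hm1 hm2
  have he : (encodeNat (bitsToNat (nthF 2 z) / 2)).length ≤ (nthF 2 z).length :=
    (length_encodeNat_mono (Nat.div_le_self _ _)).trans (length_encodeNat_bitsToNat_le _)
  have hacc : (powAccF z).length ≤ (nthF 3 z).length + mulBound.eval (fstF z).length := by
    obtain ⟨b, hb⟩ := (oneBit_parityFn.comp (nthF 2)) z
    have hite := iteFn_apply (f := nthF 3) (g := mulG ∘ fanoutFn fstF (fanoutFn (nthF 3) (sndPow 3))) hb
    simp only [powAccF, hite]
    cases b
    · simpa using hm1.trans (Nat.le_add_left _ _)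
    · simp
  have hdiv : ((divFn ∘ fanoutFn (nthF 2) (fun _ => encodeNat 2)) z).length ≤ (nthF 2 z).length := by
    simpa using he
  have hsq : ((mulG ∘ fanoutFn fstF (fanoutFn (sndPow 3) (sndPow 3))) z).length ≤ mulBound.eval (fstF z).length := by
    simpa using hm2
  rw [powBody, length_fanoutFn, length_fanoutFn]
  simp only [powGrowth, eval_add, eval_mul, eval_ofNat, Nat.reduceAdd] at h1 h2 ⊢
  omega

/-- **The rounds compute `CycList.powAux`**: from a genuine state `⟨e, ⟨pcode acc, pcode base⟩⟩` (lists of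
the same length `≤ |x|`), `k` rounds end in a state whose accumulator field is
`pcode (CycList.powAux n k ⟦e⟧ acc base)`. [cite: KnuthTAOCP2, §4.6.3 (Algorithm A)] -/
theorem loopModel_powBody {x : List Bool} (hx : 2 ≤ bitsToNat (fstF x)) : ∀ (k : ℕ) (e : List Bool) {acc base : List ℕ},
    acc.length = base.length → base.length ≤ x.length → ∃ (e' : List Bool) (base' : List ℕ),
      loopModel powBody x k (boolPair e (boolPair (pcode acc) (pcode base))) =
        boolPair e' (boolPair (pcode (CycList.powAux (bitsToNat (fstF x)) k (bitsToNat e) acc base)) (pcode base'))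
  | 0, e, acc, base, _, _ => ⟨e, base, rfl⟩
  | k + 1, e, acc, base, hab, hb => by
    have hbb : (CycList.mul (bitsToNat (fstF x)) base base).length = base.length := CycList.length_mul _ rfl
    have hacc' : (if bitsToNat e % 2 = 1 then CycList.mul (bitsToNat (fstF x)) acc base else acc).length =
        (CycList.mul (bitsToNat (fstF x)) base base).length := by
      split_ifs
      · rw [CycList.length_mul _ hab, hbb]
      · rw [hab, hbb]
    obtain ⟨e', base', h⟩ := loopModel_powBody hx k (encodeNat (bitsToNat e / 2)) hacc' (hbb.le.trans hb)
    refine ⟨e', base', ?_⟩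
    rw [loopModel, powBody_record hx _ e hab hb, h, CycList.powAux, bitsToNat_encodeNat]

/-! ### The unit and the powering brick -/

/-- **`oneOfG ⟨x, B⟩`**: the code of `CycList.one r` for a coded list `B` of `r ≥ 1` entries
(`rotF ⟨1, tail of the zero list⟩`). [folklore] -/
noncomputable def oneOfG : List Bool → List Bool := rotF ∘ fanoutFn (fun _ => [true]) (sndF ∘ zeroOfG)

/-- `oneOfG ∈ FP`. [folklore] -/
theorem oneOfG_mem_FP : oneOfG ∈ FP :=
  comp_mem_FP rotF_mem_FP (fanoutFn_mem_FP (const_mem_FP _) (comp_mem_FP sndF_mem_FP zeroOfG_mem_FP))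

/-- `encodeNat 1 = [1]`. [folklore] -/
theorem encodeNat_one : encodeNat 1 = [true] := by decide

/-- Value of `oneOfG` on a coded list of `1 ≤ r ≤ |x|` entries. [folklore] -/
theorem oneOfG_apply (x : List Bool) {B : List ℕ} (hB : B.length ≤ x.length) (hB1 : 1 ≤ B.length) :
    oneOfG (boolPair x (pcode B)) = pcode (CycList.one B.length) := by
  rw [oneOfG, Function.comp_apply, fanoutFn_apply, Function.comp_apply, zeroOfG_apply x hB]
  obtain ⟨r, hr⟩ : ∃ r, B.length = r + 1 := ⟨B.length - 1, by omega⟩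
  rw [hr, CycList.zero, List.replicate_succ, pcode_cons, sndF_boolPair, ← encodeNat_one, ← pcode_cons,
    rotF_pcode (List.cons_ne_nil _ _), CycList.rot, CycList.one, Nat.add_sub_cancel]

/-- The loop record of the powering brick: from `⟨x, B⟩` to `⟨x, ⟨bin |ν|, ⟨ν, ⟨oneOfG ⟨x, B⟩, B⟩⟩⟩⟩`,
`ν = fstF x`. [folklore] -/
noncomputable def powArg : List Bool → List Bool :=
  fanoutFn fstF (fanoutFn (lenBinF ∘ fstF ∘ fstF) (fanoutFn (fstF ∘ fstF) (fanoutFn oneOfG sndF)))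

/-- `powArg` spelled out. [folklore] -/
theorem powArg_apply (x B : List Bool) :
    powArg (boolPair x B) = boolPair x (boolPair (encodeNat (fstF x).length) (boolPair (fstF x) (boolPair (oneOfG (boolPair x B)) B))) := by
  simp [powArg]

/-- `powArg ∈ FP`. [folklore] -/
theorem powArg_mem_FP : powArg ∈ FP :=
  fanoutFn_mem_FP fstF_mem_FP (fanoutFn_mem_FP (comp_mem_FP lenBinF_mem_FP (comp_mem_FP fstF_mem_FP fstF_mem_FP))
    (fanoutFn_mem_FP (comp_mem_FP fstF_mem_FP fstF_mem_FP) (fanoutFn_mem_FP oneOfG_mem_FP sndF_mem_FP)))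

/-- **The powering brick** `powG ⟨x, B⟩`: `|ν|` rounds of `powBody` from `(⟦ν⟧, 1, B)`, then the accumulator.
[cite: AgrawalKayalSaxena2004, §5 (proof of Thm 5.1)] -/
noncomputable def powG : List Bool → List Bool := nthF 3 ∘ loopX powBody ∘ powArg

/-- **`powG ∈ FP`**: a counted loop with a body of polynomial growth. [cite: AroraBarak2009, §1.3 (bounded loops), §1.4.1] -/
theorem powG_mem_FP : powG ∈ FP :=
  comp_mem_FP (nthF_mem_FP 3) (comp_mem_FP (loopX_mem_FP powBody_mem_FP length_powBody_le) powArg_mem_FP)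

/-- **Value of the powering brick**: for `x = ⟨ν, u⟩` with `n = ⟦ν⟧ ≥ 2` and a coefficient list `B` of
`1 ≤ r ≤ |x|` entries, `powG ⟨x, pcode B⟩ = pcode (CycList.powAux n |ν| n (one r) B)` — the list of `B ^ n`
when `ν = encodeNat n` (`CycList.toQ_powAux`, `|encodeNat n| = Nat.size n`). [cite: AgrawalKayalSaxena2004, §5] -/
theorem powG_apply {x : List Bool} (hx : 2 ≤ bitsToNat (fstF x)) {B : List ℕ} (hB : B.length ≤ x.length)
    (hB1 : 1 ≤ B.length) :
    powG (boolPair x (pcode B)) =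
      pcode (CycList.powAux (bitsToNat (fstF x)) (fstF x).length (bitsToNat (fstF x)) (CycList.one B.length) B) := by
  have hlen : (fstF x).length ≤ x.length := by have := length_fstF_sndF_le x; omega
  obtain ⟨e', base', h⟩ := loopModel_powBody hx (fstF x).length (fstF x) (acc := CycList.one B.length)
    (base := B) (CycList.length_one hB1) hB
  rw [powG, Function.comp_apply, Function.comp_apply, powArg_apply, oneOfG_apply x hB hB1, loopX_apply _ _ _ hlen, h]
  simp

end Brick

end Literature.Computability.Complexity
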